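import Summits.Ventures.CertifiedArithmetic.LowPrec.RoundNearestJR
import Summits.Ventures.CertifiedArithmetic.LowPrec.AccumulateTree
import Summits.Ventures.CertifiedArithmetic.LowPrec.JRBridge
import Literature.ComputerArithmetic.JeannerodRump2018.Theorem41

/-!
# The rounding bridge (II): ties to even, and transfer of tree evaluations to the formats

HONEST FRAMING (venture CertifiedArithmetic / cell `pub-lowprec`): certified error envelopes and
provably optimal rounding/accumulation schemes for low-precision formats under stated cost models;
every table by two implementations; no hardware or vendor claims.

Continuation of `RoundNearestJR.lean` (`Format.flJR φ` = round-to-nearest-even into the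
Jeannerod–Rump model `F(m+1, qexp φ)`, proved `IsRoundNearest` and equal to the executable
saturating `roundNE φ` on `|x| ≤ maxRat φ`). Here:
* `Format.flJR_midpoint_pow`: `flJR φ (2^E·(1+u)) = 2^E` for every `E ≥ qexp φ` (`m ≥ 1`) — the
  binade midpoints go to the EVEN neighbour, i.e. the opt seat's hypothesis `TiesEvenAtPow` of
  `LowPrec/OptTreeWitness` holds for the formats' rounding;
* `MiniFloat.eval_flα_eq_eval_flJR`: on every evaluation tree whose nodes stay in range
  (`TreeInRange α`), evaluation with the format's `flα α` IS evaluation with `flJR α`, and the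
  leaves are floats of the model (`isFloat_of_mem_leaves`);
* first instance of the transfer: [JeannerodRump2018, eq. (1.3)] `|ŝ - s| ≤ (n-1)u/(1+u)·Σ|xᵢ|`
  for every format and evaluation order, obtained from the LITERATURE proof `sumError_le_holds`
  (any nearest map on `F(p, emin)`), not re-proved (`abs_eval_flα_sub_exact_le_literature`).

Placement: venture development; dot-notation extensions of the Literature structures `Format` /
`MiniFloat` (CONVENTIONS §2).
-/

namespace Literature.ComputerArithmetic.FloatingPoint

open Literature.ComputerArithmetic.JeannerodRump2018

namespace Format

variable {φ : Format}

/-! ### Ties to even at the binade midpoints -/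

/-- **TIES TO EVEN**: the midpoint `2^E (1 + u)`, `u = 2^-(m+1)`, of the consecutive floats `2^E`
and `2^E (1 + 2u)` goes to `2^E` (even significand `2^m`) for every `E ≥ qexp φ`, `m ≥ 1`; for
`E < qexp + m` the point `2^E (1+u)` is not a midpoint and `2^E` is its unique nearest float.
This is the hypothesis `TiesEvenAtPow (m+1) (qexp φ)` of `LowPrec/OptTreeWitness`.
[cite: IEEE7542019, §4.3.1] -/
theorem flJR_midpoint_pow (hm : 1 ≤ φ.manBits) {E : ℤ} (hE : φ.qexp ≤ E) :
    φ.flJR ((2 : ℚ) ^ E + (2 : ℚ) ^ E * (1 / 2 ^ (φ.manBits + 1))) = (2 : ℚ) ^ E := by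
  have h2E : (0 : ℚ) < (2 : ℚ) ^ E := zpow_pos (by norm_num) E
  have hP : (0 : ℚ) < 2 ^ (φ.manBits + 1) := by positivity
  set x : ℚ := (2 : ℚ) ^ E + (2 : ℚ) ^ E * (1 / 2 ^ (φ.manBits + 1)) with hx_def
  have hxpos : 0 < x := by positivity
  have habs : |x| = x := abs_of_pos hxpos
  -- `⌊log₂ x⌋ = E`
  have hlog : Int.log 2 |x| = E := by
    rw [habs]
    have hlo : ((2 : ℕ) : ℚ) ^ E ≤ x := by
      rw [Nat.cast_ofNat, hx_def]; exact le_add_of_nonneg_right (by positivity)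
    have hhi : x < ((2 : ℕ) : ℚ) ^ (E + 1) := by
      rw [Nat.cast_ofNat, zpow_add₀ (by norm_num : (2 : ℚ) ≠ 0), zpow_one, hx_def]
      have : (2 : ℚ) ^ E * (1 / 2 ^ (φ.manBits + 1)) < (2 : ℚ) ^ E := by
        rw [mul_lt_iff_lt_one_right h2E, div_lt_one hP]
        exact one_lt_pow₀ (by norm_num) (by omega)
      linarith
    have h1 := (Int.zpow_le_iff_le_log (b := 2) (by norm_num) hxpos).mp hlo
    have h2 := (Int.lt_zpow_iff_log_lt (b := 2) (by norm_num) hxpos).mp hhi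
    omega
  rw [flJR_of_nonneg hxpos.le]
  unfold flJRMag
  rw [habs]
  unfold gridExp
  rw [hlog]
  rcases le_or_gt φ.qexp (E - φ.manBits) with hbig | hsmall
  · -- normal binade: scaled value `2^m + 1/2`, a tie, even side `2^m`
    rw [max_eq_right hbig]
    have hscale : x / (2 : ℚ) ^ (E - (φ.manBits : ℤ)) = ((2 ^ φ.manBits : ℤ) : ℚ) + 1 / 2 := by
      rw [div_eq_iff (zpow_pos (by norm_num : (0 : ℚ) < 2) _).ne', hx_def,
        show (E : ℤ) = (E - φ.manBits) + (φ.manBits : ℕ) by ring,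
        zpow_add₀ (by norm_num : (2 : ℚ) ≠ 0), zpow_natCast]
      push_cast
      rw [show (E - (φ.manBits : ℤ) + (φ.manBits : ℤ) - (φ.manBits : ℤ)) = E - (φ.manBits : ℤ) by ring,
        pow_succ]
      field_simp
    rw [hscale, rneInt_intCast_add_half_of_even (dvd_pow_self 2 (by omega))]
    push_cast
    rw [← zpow_natCast, ← zpow_add₀ (by norm_num : (2 : ℚ) ≠ 0)]
    congr 1; ring
  · -- gradual-underflow range: scaled value `2^d + 2^d/2^(m+1)` with `d = E - qexp < m`
    rw [max_eq_left hsmall.le]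
    obtain ⟨d, hd⟩ := Int.eq_ofNat_of_zero_le (sub_nonneg.mpr hE)
    have hdm : d + 2 ≤ φ.manBits + 1 := by omega
    have hscale : x / (2 : ℚ) ^ φ.qexp = ((2 ^ d : ℤ) : ℚ) + (2 : ℚ) ^ d * (1 / 2 ^ (φ.manBits + 1)) := by
      rw [div_eq_iff (zpow_pos (by norm_num : (0 : ℚ) < 2) _).ne', hx_def,
        show (E : ℤ) = φ.qexp + (d : ℕ) by omega, zpow_add₀ (by norm_num : (2 : ℚ) ≠ 0), zpow_natCast]
      push_cast; ring
    have hfrac0 : (0 : ℚ) ≤ (2 : ℚ) ^ d * (1 / 2 ^ (φ.manBits + 1)) := by positivity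
    have hfrac : (2 : ℚ) ^ d * (1 / 2 ^ (φ.manBits + 1)) < 1 / 2 := by
      rw [mul_one_div, div_lt_iff₀ hP]
      have : (2 : ℚ) ^ d * 2 * 2 ≤ 2 ^ (φ.manBits + 1) := by
        rw [← pow_succ, ← pow_succ]; exact pow_le_pow_right₀ (by norm_num) hdm
      linarith [pow_pos (by norm_num : (0 : ℚ) < 2) d]
    rw [hscale, rneInt_intCast_add_of_lt_half _ hfrac0 hfrac]
    push_cast
    rw [← zpow_natCast, ← zpow_add₀ (by norm_num : (2 : ℚ) ≠ 0)]
    congr 1; omega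

end Format

/-! ### Transfer to evaluation trees in a format -/

namespace MiniFloat

open Literature.ComputerArithmetic.JeannerodRump2018.SumTree

variable {α : Format}

/-- In range, the format's evaluation map is the model rounding. [folklore] -/
theorem flα_eq_flJR {t : ℚ} (h : |t| ≤ α.maxRat) : flα α t = α.flJR t :=
  (Format.flJR_eq_roundNE h).symm

/-- **TRANSFER**: an evaluation tree whose every node stays in range evaluates in the format
exactly as under the model rounding `flJR α`. [folklore] -/
theorem eval_flα_eq_eval_flJR : ∀ t : SumTree, TreeInRange α t →
    SumTree.eval (flα α) t = SumTree.eval α.flJR t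
  | .leaf _, _ => rfl
  | .node l r, ⟨hl, hr, hrange⟩ => by
      simp only [SumTree.eval]
      rw [← eval_flα_eq_eval_flJR l hl, ← eval_flα_eq_eval_flJR r hr]
      exact flα_eq_flJR hrange

/-- The leaves of an in-range tree are floats of `F(m+1, qexp α)`. [folklore] -/
theorem isFloat_of_mem_leaves : ∀ t : SumTree, TreeInRange α t →
    ∀ x ∈ SumTree.leaves t, IsFloat (α.manBits + 1) α.qexp x
  | .leaf _, ⟨y, hy⟩, x, hx => by
      simp only [SumTree.leaves, List.mem_singleton] at hx
      rw [hx, ← hy]; exact isFloat_toRat y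
  | .node l r, ⟨hl, hr, _⟩, x, hx => by
      simp only [SumTree.leaves, List.mem_append] at hx
      rcases hx with hx | hx
      · exact isFloat_of_mem_leaves l hl x hx
      · exact isFloat_of_mem_leaves r hr x hx

/-- FIRST INSTANCE OF THE TRANSFER — [JeannerodRump2018] eq. (1.3) for the bit-level formats,
obtained from the LITERATURE proof (`sumError_le_holds`, any nearest map on `F(p, emin)`), not
re-proved: leaves in `F_α`, nodes in range, `m ≥ 1` ⟹ `|ŝ - s| ≤ (n-1)·u/(1+u)·Σ|xᵢ|` for every
evaluation order. (The cell's direct proof is `abs_eval_sub_exact_le_sharp`, AccumulateSharp.)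
[cite: JeannerodRump2018, eq. (1.3)] -/
theorem abs_eval_flα_sub_exact_le_literature (hm : 1 ≤ α.manBits) (t : SumTree)
    (ht : TreeInRange α t) :
    |SumTree.eval (flα α) t - SumTree.exact t|
      ≤ ((t.leaves.length - 1 : ℕ) : ℚ)
          * (unitRoundoff (α.manBits + 1) / (1 + unitRoundoff (α.manBits + 1)))
          * (t.leaves.map abs).sum := by
  rw [eval_flα_eq_eval_flJR t ht]
  exact sumError_le_holds (α.manBits + 1) α.qexp α.flJR (by omega) (Format.isRoundNearest_flJR α) t
    (isFloat_of_mem_leaves t ht)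

/-- Kernel sanity check (bfloat16): the model rounding and the executable one agree on the tie
`1 + u ↦ 1` and on `1 + 3u ↦ 1 + 4u` (ties to even both ways). -/
example : Format.BFloat16.flJR (1 + 1 / 256) = 1 ∧ flα Format.BFloat16 (1 + 1 / 256) = 1 ∧
    Format.BFloat16.flJR (1 + 3 / 256) = 1 + 4 / 256 ∧
    flα Format.BFloat16 (1 + 3 / 256) = 1 + 4 / 256 := by
  refine ⟨by decide +kernel, by decide +kernel, by decide +kernel, by decide +kernel⟩

end MiniFloat

end Literature.ComputerArithmetic.FloatingPoint
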